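import Mathlib
import Literature.NumberTheory.Transcendental.KZCalculus
import Summits.KontsevichZagierPeriods.KontsevichZagierPeriods.Theses.UnfoldedStokes
import Summits.KontsevichZagierPeriods.KontsevichZagierPeriods.Theorems.UnfoldedStokesHyperellipticRiemannRelationStubEngine
import Summits.KontsevichZagierPeriods.KontsevichZagierPeriods.Theorems.UnfoldedStokesHyperellipticRiemannRelationStubSwapGlue
import Summits.KontsevichZagierPeriods.KontsevichZagierPeriods.Theorems.UnfoldedStokesHyperellipticRiemannRelationStubBoxReps
import Summits.KontsevichZagierPeriods.KontsevichZagierPeriods.Theorems.UnfoldedStokesHyperellipticRiemannRelationStubBounds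
import Summits.KontsevichZagierPeriods.KontsevichZagierPeriods.Theorems.UnfoldedStokesHyperellipticRiemannRelationStubFaces
import Summits.KontsevichZagierPeriods.KontsevichZagierPeriods.Theorems.UnfoldedStokesHyperellipticRiemannRelationStubKernelIntegrable
import Summits.KontsevichZagierPeriods.KontsevichZagierPeriods.Theorems.UnfoldedStokesHyperellipticRiemannRelationStubKernelCalculus

/-!
# `HyperellipticRiemannRelation` (stmt-KontsevichZagierPeriods-3522), line `SketchIdeator2`
# (locked-slab-simplex, reshaped by the lead: fibred half-plane transport) — CLOSING FILE

Riemann's bilinear relation for the two first-kind forms `dx/y`, `x dx/y` of the genus-2 curve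
`y² = P(x) = ∏_{i<5} (x − eᵢ)` (`e` strictly increasing, rational), interval form
`[J₁×J₂, g] − [J₁×J₄, g] + [J₃×J₄, g] ∈ KZ.relations`, `g(x₀,x₁) = (x₁ − x₀)/√(|P(x₀)||P(x₁)|)`.

Chain. With `Φ(z) = ∏ⱼ √(z − eⱼ)` (principal roots; holomorphic on the upper half-plane `H`, boundary
phases `(−i,1,i,−1,−i,1)⁻¹` on the six gaps `J₀ = (−∞,e₀), J₁, …, J₄, J₅ = (e₄,∞)`), the ORDERED kernel
`K(x₀,x₁,s) = (x₁+is)/(Φ(x₀+is)Φ(x₁+is))` (form `dx/y` at the left point, `x dx/y` at the right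
point, both at the SAME height `s`) satisfies the transport law `∂ₛK = i ∂_τ K` along the joint
translation `(x₀,x₁) = (τ−u, τ)`, `u > 0` a spectator.  ONE Newton–Leibniz move along the
compactified height `σ = s/(1+s) ∈ [0,1]` (primitive `Im K`, zero at `σ = 1`) and ONE along the
compactified abscissa `τ` (primitive `Re K/(1−σ)²`, zero at `τ = ±∞`) show that the bottom face
`[{u>0}×ℝ, Im K(τ−u,τ,0)]` is a relation (`stub_engine`, an abstract two-move lemma, fed by the
analytic packages `stub_kernelCalculus`, `stub_kernelIntegrable`, `stub_bounds`).  Sheared back to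
`{x₀ < x₁}` and cut along the gap grid, that face is the nine-term identity
`−P₀₁ + P₀₃ − P₀₅ + P₁₂ − P₁₄ − P₂₃ + P₂₅ + P₃₄ − P₄₅ ≡ 0`, `Pⱼₖ = [Jⱼ×Jₖ, x₁/√(|P(x₀)||P(x₁)|)]`
(`stub_faces`, first conjunct; same-type boxes and diagonal triangles carry the zero integrand).
The same engine with the spectator `x₀ ∈ J_L` frozen at height `0` and the one-point kernel
`x₁ ↦ (x₁+is)/Φ(x₁+is)` gives the fibred linear relations `P_{L1} − P_{L3} + P_{L5} ≡ 0`
(`stub_faces`, second conjunct), and `(x₀,x₁) ↦ (x₁,x₀)` (rule 2) with `g = f − f∘swap`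
(rule 1b) (`stub_swapGlue`) lands on the crux:
`crux = N′ + SL(0) − SL(2) + SL(4)` in the free abelian group.  Box representations exist by
`stub_boxReps`.  `HyperellipticRiemannRelation_of` composes the seven stubs (all landed as
`Theorems/UnfoldedStokesHyperellipticRiemannRelationStub*.lean`, imported above) and concludes the
route declaration BY NAME.  No definitions are introduced: every object is written out, and the kernels
enter the stubs through defining hypotheses (`hΦ : ∀ z, Φ z = …`, `hV : ∀ w, V w = …`).

References: Kontsevich–Zagier 2001 §1.2 (rules 1–3); Farkas–Kra 1992 III.3.1 (3.1.1) (the value);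
Griffiths–Harris 1978 Ch. 2 §2 (cut-surface proof, avoided here); Bochnak–Coste–Roy 1998 §2.2.
-/

noncomputable section


-- `Summit.<Summit>.<Sub>` with Sub = Summit (single-conjunct summit, D-0017) duplicates the segment.
set_option linter.dupNamespace false

namespace Summit.KontsevichZagierPeriods.KontsevichZagierPeriods.Theorems

open Set MeasureTheory Filter Topology
open Literature.NumberTheory.Transcendental
open Literature.ModelTheory.ExponentialFields (IsSemialgebraic)
open Summit.KontsevichZagierPeriods.UnfoldedStokes.HyperellipticRiemannRelationLine

set_option maxHeartbeats 800000 in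
/-- **Riemann's bilinear relation for the genus-2 curve `y² = ∏_{i<5}(x − eᵢ)` in interval form**
(crux `HyperellipticRiemannRelation`, stmt-KontsevichZagierPeriods-3522):
`[J₁×J₂, g] − [J₁×J₄, g] + [J₃×J₄, g] ∈ KZ.relations`.  Composition of the seven stubs: the crux
is `N′ + SL(0) − SL(2) + SL(4)` up to the antisymmetrisation glue, where the nine-term face `N′` and
the fibred linear relations `SL(L)` are the bottom faces of the two transport prisms.
[cite: KontsevichZagier2001, §1.2] -/
theorem HyperellipticRiemannRelation_of :
    Summit.KontsevichZagierPeriods.KontsevichZagierPeriods.Theses.UnfoldedStokes.HyperellipticRiemannRelation := by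
  intro e he r12 r14 r34 h12d h14d h34d h12i h14i h34i
  -- the written-out objects
  set Φ : ℂ → ℂ := fun z => ∏ j : Fin 5, Complex.sqrt (z - ((e j : ℝ) : ℂ)) with hΦdef
  have hΦ : ∀ z, Φ z = ∏ j : Fin 5, Complex.sqrt (z - ((e j : ℝ) : ℂ)) := fun z => rfl
  set m : ℝ → ℝ := fun x =>
    (1 + ∑ k : Fin 5, |x - (e k : ℝ)| ^ (-(3:ℝ) / 4)) * (1 + x ^ 2) ^ (-(5:ℝ) / 8) with hmdef
  have hm : ∀ x, m x =
      (1 + ∑ k : Fin 5, |x - (e k : ℝ)| ^ (-(3:ℝ) / 4)) * (1 + x ^ 2) ^ (-(5:ℝ) / 8) :=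
    fun x => rfl
  set J : Fin 6 → Set ℝ := ![Set.Iio (e 0 : ℝ), Set.Ioo (e 0 : ℝ) (e 1 : ℝ),
      Set.Ioo (e 1 : ℝ) (e 2 : ℝ), Set.Ioo (e 2 : ℝ) (e 3 : ℝ), Set.Ioo (e 3 : ℝ) (e 4 : ℝ),
      Set.Ioi (e 4 : ℝ)] with hJ
  set f : (Fin 2 → ℝ) → ℝ := fun x =>
    x 1 / Real.sqrt (|∏ i : Fin 5, (x 0 - (e i : ℝ))| * |∏ i : Fin 5, (x 1 - (e i : ℝ))|) with hfdef
  have hf : ∀ x, f x =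
      x 1 / Real.sqrt (|∏ i : Fin 5, (x 0 - (e i : ℝ))| * |∏ i : Fin 5, (x 1 - (e i : ℝ))|) :=
    fun x => rfl
  set ρ : ℝ → ℝ := fun t => 1 / Real.sqrt |∏ i : Fin 5, (t - (e i : ℝ))| with hρdef
  have hρ : ∀ t, ρ t = 1 / Real.sqrt |∏ i : Fin 5, (t - (e i : ℝ))| := fun t => rfl
  -- shared analysis
  have hbounds := stub_bounds e he Φ hΦ m hm
  obtain ⟨hcalc0, hcalc1⟩ := stub_kernelCalculus e he Φ hΦ m hm hbounds
  obtain ⟨hint0, hint1⟩ := stub_kernelIntegrable e he Φ hΦ m hm hbounds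
  obtain ⟨⟨G₂, hG₂d, hG₂i⟩, hbox⟩ := stub_boxReps e he Φ hΦ m hm hbounds J hJ f hf
  obtain ⟨hfaceS, hfaceC⟩ := stub_faces e he Φ hΦ J hJ f hf G₂ hG₂d hG₂i
  -- the twelve boxes
  obtain ⟨p01, h01⟩ := hbox 0 1
  obtain ⟨p03, h03⟩ := hbox 0 3
  obtain ⟨p05, h05⟩ := hbox 0 5
  obtain ⟨p12, h12⟩ := hbox 1 2
  obtain ⟨p14, h14⟩ := hbox 1 4
  obtain ⟨p21, h21⟩ := hbox 2 1
  obtain ⟨p23, h23⟩ := hbox 2 3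
  obtain ⟨p25, h25⟩ := hbox 2 5
  obtain ⟨p34, h34⟩ := hbox 3 4
  obtain ⟨p41, h41⟩ := hbox 4 1
  obtain ⟨p43, h43⟩ := hbox 4 3
  obtain ⟨p45, h45⟩ := hbox 4 5
  -- antisymmetrisation glue on the three crux boxes
  have hJ1 : J 1 = Set.Ioo (e 0 : ℝ) (e 1 : ℝ) := by rw [hJ]; rfl
  have hJ2 : J 2 = Set.Ioo (e 1 : ℝ) (e 2 : ℝ) := by rw [hJ]; rfl
  have hJ3 : J 3 = Set.Ioo (e 2 : ℝ) (e 3 : ℝ) := by rw [hJ]; rfl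
  have hJ4 : J 4 = Set.Ioo (e 3 : ℝ) (e 4 : ℝ) := by rw [hJ]; rfl
  have g12 : KZ.of r12 - KZ.of p12 + KZ.of p21 ∈ KZ.relations :=
    stub_swapGlue e (e 0) (e 1) (e 1) (e 2) r12 p12 p21 h12d h12i
      (by rw [h12.1, hJ1, hJ2]) h12.2 (by rw [h21.1, hJ1, hJ2]) h21.2
  have g14 : KZ.of r14 - KZ.of p14 + KZ.of p41 ∈ KZ.relations :=
    stub_swapGlue e (e 0) (e 1) (e 3) (e 4) r14 p14 p41 h14d h14i
      (by rw [h14.1, hJ1, hJ4]) h14.2 (by rw [h41.1, hJ1, hJ4]) h41.2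
  have g34 : KZ.of r34 - KZ.of p34 + KZ.of p43 ∈ KZ.relations :=
    stub_swapGlue e (e 2) (e 3) (e 3) (e 4) r34 p34 p43 h34d h34i
      (by rw [h34.1, hJ3, hJ4]) h34.2 (by rw [h43.1, hJ3, hJ4]) h43.2
  -- the simplex kernel and the nine-term identity
  set K : ℝ → ℝ → ℝ → ℂ := fun x₀ x₁ s => ((x₁ : ℂ) + (s : ℂ) * Complex.I) /
    (Φ ((x₀ : ℂ) + (s : ℂ) * Complex.I) * Φ ((x₁ : ℂ) + (s : ℂ) * Complex.I)) with hKdef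
  set K' : ℝ → ℝ → ℝ → ℂ := fun x₀ x₁ s =>
    (1 - ((x₁ : ℂ) + (s : ℂ) * Complex.I) / 2 *
      ∑ j : Fin 5, (((x₀ : ℂ) + (s : ℂ) * Complex.I - ((e j : ℝ) : ℂ))⁻¹ +
        ((x₁ : ℂ) + (s : ℂ) * Complex.I - ((e j : ℝ) : ℂ))⁻¹)) /
    (Φ ((x₀ : ℂ) + (s : ℂ) * Complex.I) * Φ ((x₁ : ℂ) + (s : ℂ) * Complex.I)) with hK'def
  set V : (Fin 3 → ℝ) → ℝ := fun w =>
    if w 2 < 1 then (K (w 1 - w 0) (w 1) (w 2 / (1 - w 2))).im else 0 with hVdef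
  set U : (Fin 3 → ℝ) → ℝ := fun w =>
    1 / (1 - w 2) ^ 2 * (K (w 1 - w 0) (w 1) (w 2 / (1 - w 2))).re with hUdef
  set B : (Fin 3 → ℝ) → ℝ := fun w =>
    1 / (1 - w 2) ^ 2 * (K' (w 1 - w 0) (w 1) (w 2 / (1 - w 2))).re with hBdef
  obtain ⟨hE1, hE2a, hE2b, hE2c, hE3, hE4, hE5B, hE5U, hE6⟩ :=
    hcalc0 K K' V U B (fun _ _ _ => rfl) (fun _ _ _ => rfl) (fun _ => rfl) (fun _ => rfl)
      (fun _ => rfl)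
  have hE5i := hint0 K' B (fun _ _ _ => rfl) (fun _ => rfl)
  obtain ⟨F, hFd, hFi, hFrel⟩ := hfaceS p01 p03 p05 p12 p14 p23 p25 p34 p45
    h01 h03 h05 h12 h14 h23 h25 h34 h45
  have hF : KZ.of F ∈ KZ.relations := by
    refine stub_engine (Ioi (0:ℝ))
      {y : Fin 2 → ℝ | 0 < y 0 ∧ ∀ j, y 1 ≠ (e j : ℝ) ∧ y 1 - y 0 ≠ (e j : ℝ)} V U B
      hE1 hE2a hE2b hE2c hE3 hE4 hE5B hE5U hE5i hE6 F hFd ?_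
    intro y hy
    rw [hFi hy]
    simp [hVdef, hKdef]
  have hN : -KZ.of p01 + KZ.of p03 - KZ.of p05 + KZ.of p12 - KZ.of p14 - KZ.of p23
      + KZ.of p25 + KZ.of p34 - KZ.of p45 ∈ KZ.relations := by
    have := KZ.relations.sub_mem hF hFrel
    simpa using this
  -- the spectator kernel and the three fibred linear relations
  set k : ℝ → ℝ → ℂ := fun x s =>
    ((x : ℂ) + (s : ℂ) * Complex.I) / Φ ((x : ℂ) + (s : ℂ) * Complex.I) with hkdef
  set k' : ℝ → ℝ → ℂ := fun x s =>
    (1 - ((x : ℂ) + (s : ℂ) * Complex.I) / 2 *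
      ∑ j : Fin 5, ((x : ℂ) + (s : ℂ) * Complex.I - ((e j : ℝ) : ℂ))⁻¹) /
    Φ ((x : ℂ) + (s : ℂ) * Complex.I) with hk'def
  set V₁ : (Fin 3 → ℝ) → ℝ := fun w =>
    if w 2 < 1 then ρ (w 0) * (k (w 1) (w 2 / (1 - w 2))).re else 0 with hV₁def
  set U₁ : (Fin 3 → ℝ) → ℝ := fun w =>
    -(1 / (1 - w 2) ^ 2 * ρ (w 0) * (k (w 1) (w 2 / (1 - w 2))).im) with hU₁def
  set B₁ : (Fin 3 → ℝ) → ℝ := fun w =>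
    -(1 / (1 - w 2) ^ 2 * ρ (w 0) * (k' (w 1) (w 2 / (1 - w 2))).im) with hB₁def
  have hcalcL := hcalc1 ρ k k' V₁ U₁ B₁ hρ (fun _ _ => rfl) (fun _ _ => rfl) (fun _ => rfl)
    (fun _ => rfl) (fun _ => rfl)
  have hintL := hint1 ρ k' B₁ hρ (fun _ _ => rfl) (fun _ => rfl)
  have hSL : ∀ (L : Fin 6) (q1 q3 q5 : KZ.IntegralRep 2),
      (q1.domain = {x | x 0 ∈ J L ∧ x 1 ∈ J 1} ∧ q1.integrand = f) →
      (q3.domain = {x | x 0 ∈ J L ∧ x 1 ∈ J 3} ∧ q3.integrand = f) →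
      (q5.domain = {x | x 0 ∈ J L ∧ x 1 ∈ J 5} ∧ q5.integrand = f) →
      KZ.of q1 - KZ.of q3 + KZ.of q5 ∈ KZ.relations := by
    intro L q1 q3 q5 hq1 hq3 hq5
    obtain ⟨Fc, hFcd, hFci, hFcrel⟩ := hfaceC ρ hρ L q1 q3 q5 hq1 hq3 hq5
    obtain ⟨hL1, hL2a, hL2b, hL2c, hL3, hL4, hL5B, hL5U, hL6⟩ := hcalcL L
    have hFc : KZ.of Fc ∈ KZ.relations := by
      refine stub_engine (J L) {y : Fin 2 → ℝ | y 0 ∈ J L ∧ ∀ j, y 1 ≠ (e j : ℝ)} V₁ U₁ B₁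
        (by simpa only [hJ] using hL1) (by simpa only [hJ] using hL2a)
        (by simpa only [hJ] using hL2b) (by simpa only [hJ] using hL2c)
        (by simpa only [hJ] using hL3) (by simpa only [hJ] using hL4)
        (by simpa only [hJ] using hL5B) (by simpa only [hJ] using hL5U)
        (by simpa only [hJ] using hintL L) (by simpa only [hJ] using hL6) Fc hFcd ?_
      intro y hy
      rw [hFci hy]
      simp [hV₁def, hkdef]
    have := KZ.relations.sub_mem hFc hFcrel
    simpa using this
  have hSL0 := hSL 0 p01 p03 p05 h01 h03 h05
  have hSL2 := hSL 2 p21 p23 p25 h21 h23 h25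
  have hSL4 := hSL 4 p41 p43 p45 h41 h43 h45
  -- free-abelian-group bookkeeping
  have key : KZ.of r12 - KZ.of r14 + KZ.of r34 =
      (KZ.of r12 - KZ.of p12 + KZ.of p21) - (KZ.of r14 - KZ.of p14 + KZ.of p41)
        + (KZ.of r34 - KZ.of p34 + KZ.of p43)
        + (-KZ.of p01 + KZ.of p03 - KZ.of p05 + KZ.of p12 - KZ.of p14 - KZ.of p23
            + KZ.of p25 + KZ.of p34 - KZ.of p45)
        + (KZ.of p01 - KZ.of p03 + KZ.of p05)
        - (KZ.of p21 - KZ.of p23 + KZ.of p25)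
        + (KZ.of p41 - KZ.of p43 + KZ.of p45) := by
    abel
  rw [key]
  refine KZ.relations.add_mem (KZ.relations.sub_mem (KZ.relations.add_mem
    (KZ.relations.add_mem (KZ.relations.add_mem (KZ.relations.sub_mem g12 g14) g34) hN) hSL0)
    hSL2) hSL4

end Summit.KontsevichZagierPeriods.KontsevichZagierPeriods.Theorems
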